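import Mathlib
import Literature.NumberTheory.Irrationality.Fischler2002.JnChiProofs
import HarnessLib

/-!
# Fischler 2002 §3: the nested coordinates `u_k = δ_k(x)` of the `n`-fold family `𝒥(p)` — the zigzag cell and its reversal

Topic `Literature/NumberTheory/Irrationality/Fischler2002`; proofs-only companion of `RhinViolaGroupsGeneral.lean` (first of two
files discharging its NAMED FACT `Jn_psi`; the discharge `Jn_psi_holds` is in `JnPsiProofs.lean`). Cell `pub-zeta5`, seat ct-1 g30,
2026-08-27. Source: S. Fischler, « Formes linéaires en polyzêtas et intégrales multiples », C. R. Acad. Sci. Paris Sér. I **335**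
(2002) 1–4 = arXiv:math/0202064 [Fischler2002Polyzetas], §3 p. 3: "des changements de variables montrent qu'on a
`𝒥(p) = 𝒥(σ(p)) = 𝒥(ψ(p))` pour tout `p`" (journal version: S. Fischler, *Groupes de Rhin-Viola et intégrales multiples*, J. Théor.
Nombres Bordeaux **15** (2003) 479–534 [Fischler2003RhinViola], §4.2 Prop. 14 with Prop. 11).

HONEST FRAMING (cells pub-zeta5 / zeta5-irr): systematic search; no irrationality claim unless certified. Identities between
(possibly infinite) `n`-fold integrals of non-negative functions; not an irrationality statement; nothing about `ζ(5)`.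

## Content (theorems only; no definition, no new named fact)
The change of variables behind `ψ` is the passage to the NESTED COORDINATES `u_k = δ_k(x)` (`δ_k = 1 − x_kδ_{k−1}`, `δ₀ = 1`),
under which the open cube `(0,1)^n` is mapped onto the ZIGZAG CELL `{u ∈ (0,1)^n : u_{k−1} + u_k > 1}` with `dx = du/∏_{k<n} u_k`
(inverse `x_k = (1 − u_k)/u_{k−1}`), followed by the coordinate REVERSAL `u_k ↦ u_{n+1−k}` of the cell. This file proves, for every
`n` and every measurable `G ≥ 0`, the SUBSTITUTION THEOREM
`∫⁻_{cell} G(u) du = ∫⁻_{(0,1)^n} G(δ₁(x),…,δ_n(x)) · ∏_{k<n} δ_k(x) dx` (`lintegral_cell_eq_lintegral_cube`) WITHOUT an `n × n`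
Jacobian: by induction on `n`, splitting off the last coordinate (Tonelli via `MeasurableEquiv.piFinSuccAbove`, on the cube side the
tree's `JnChi.lintegral_openCube_succ`), the fibre of the `(m+1)`-cell over `u′ = δ(x′)` being the interval `(1 − δ_m(x′), 1)`, on
which `s = 1 − tδ_m(x′)` is the one-dimensional affine substitution (`lintegral_image_eq_lintegral_abs_deriv_mul`); and the
REVERSAL INVARIANCE `∫⁻_{cell} G(u) du = ∫⁻_{cell} G(u_n,…,u₁) du` (`lintegral_cell_rev`; `volume_measurePreserving_piCongrLeft` at
`Fin.revPerm`). To keep the file proofs-only, the cell and the coordinate map are not given names: they are written out as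
`{u | (∀ i, 0 < u i ∧ u i < 1) ∧ ∀ i j, j = i+1 → 1 < u i + u j}` and `fun i => deltaV x (i+1)`.
-/

noncomputable section

namespace Literature.NumberTheory.Irrationality.Fischler2002

open MeasureTheory Set Finset
open scoped ENNReal

namespace JnPsi

open JnChi

/-! ### Tonelli over `ℝ^{m+1} ≅ ℝ^m × ℝ`, the last coordinate innermost -/

/-- `(u′, s) ↦ (u′, s) ∈ ℝ^{m+1}` (`Fin.snoc`) is jointly measurable. [cite: Fischler2003RhinViola, §4.2 Proposition 14 (with Prop. 11)] -/
theorem measurable_snoc_prod {m : ℕ} :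
    Measurable fun z : (Fin m → ℝ) × ℝ => (Fin.snoc z.1 z.2 : Fin (m + 1) → ℝ) := by
  refine measurable_pi_lambda _ fun i => ?_
  by_cases hi : i = Fin.last m
  · subst hi
    simp only [Fin.snoc_last]
    exact measurable_snd
  · rw [← Fin.castSucc_castPred i hi]
    simp only [Fin.snoc_castSucc]
    exact (measurable_pi_apply _).comp measurable_fst

/-- **Tonelli on `ℝ^{m+1}` with the last coordinate innermost**: for measurable `F ≥ 0`,
`∫⁻_{ℝ^{m+1}} F = ∫⁻_{u′ ∈ ℝ^m} ∫⁻_{s ∈ ℝ} F(u′, s)` (the measure-preserving split `MeasurableEquiv.piFinSuccAbove` at the last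
index). [cite: Fischler2003RhinViola, §4.2 Proposition 14 (with Prop. 11)] -/
theorem lintegral_eq_lintegral_snoc {m : ℕ} (F : (Fin (m + 1) → ℝ) → ℝ≥0∞) (hF : Measurable F) :
    ∫⁻ x, F x = ∫⁻ x' : Fin m → ℝ, ∫⁻ t : ℝ, F (Fin.snoc x' t) := by
  set e := MeasurableEquiv.piFinSuccAbove (fun _ : Fin (m + 1) => ℝ) (Fin.last m) with he
  have hmp := volume_preserving_piFinSuccAbove (fun _ : Fin (m + 1) => ℝ) (Fin.last m)
  rw [← hmp.symm.lintegral_comp_emb e.symm.measurableEmbedding F]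
  rw [show (volume : Measure (ℝ × (Fin m → ℝ))) = (volume : Measure ℝ).prod (volume : Measure (Fin m → ℝ))
      from rfl,
    lintegral_prod_symm (fun z => F (e.symm z)) ((hF.comp e.symm.measurable).aemeasurable)]
  refine lintegral_congr fun x' => lintegral_congr fun t => ?_
  have hsymm : e.symm (t, x') = Fin.snoc x' t := by
    rw [he, MeasurableEquiv.piFinSuccAbove_symm_apply]
    simp [Fin.insertNthEquiv, Fin.insertNth_last']
  rw [hsymm]

/-- Set version: `∫⁻_{x ∈ S} F = ∫⁻_{u′} ∫⁻_{s} 𝟙_S(u′, s) F(u′, s)`. [cite: Fischler2003RhinViola, §4.2 Proposition 14 (with Prop. 11)] -/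
theorem setLIntegral_eq_lintegral_snoc {m : ℕ} {S : Set (Fin (m + 1) → ℝ)} (hS : MeasurableSet S)
    (F : (Fin (m + 1) → ℝ) → ℝ≥0∞) (hF : Measurable F) :
    ∫⁻ x in S, F x = ∫⁻ x' : Fin m → ℝ, ∫⁻ t : ℝ, S.indicator F (Fin.snoc x' t) := by
  rw [← lintegral_indicator hS, lintegral_eq_lintegral_snoc _ (hF.indicator hS)]

/-! ### The one-dimensional affine substitution `s = 1 − c·t` -/

/-- For `c > 0`: `∫⁻_{s ∈ (1−c, 1)} h(s) = c · ∫⁻_{t ∈ (0,1)} h(1 − ct)` (the substitution `s = 1 − ct`, `ds = c dt`).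
[cite: Fischler2003RhinViola, §4.2 Proposition 14 (with Prop. 11)] -/
theorem lintegral_Ioo_one_sub_mul {c : ℝ} (hc : 0 < c) (h : ℝ → ℝ≥0∞) :
    ∫⁻ s in Ioo (1 - c) 1, h s = ENNReal.ofReal c * ∫⁻ t in Ioo (0:ℝ) 1, h (1 - c * t) := by
  have himg : (fun t : ℝ => 1 - c * t) '' Ioo (0:ℝ) 1 = Ioo (1 - c) 1 := by
    ext s
    simp only [Set.mem_image, Set.mem_Ioo]
    constructor
    · rintro ⟨t, ⟨ht0, ht1⟩, rfl⟩
      constructor <;> nlinarith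
    · rintro ⟨hs0, hs1⟩
      refine ⟨(1 - s) / c, ⟨div_pos (by linarith) hc, ?_⟩, ?_⟩
      · rw [div_lt_one hc]; linarith
      · field_simp
        ring
  have hderiv : ∀ t ∈ Ioo (0:ℝ) 1, HasDerivWithinAt (fun t : ℝ => 1 - c * t) (-c) (Ioo (0:ℝ) 1) t := by
    intro t _
    have h1 : HasDerivAt (fun t : ℝ => 1 - c * t) (-c) t := by
      simpa using ((hasDerivAt_id t).const_mul c).const_sub 1
    exact h1.hasDerivWithinAt
  have hinj : InjOn (fun t : ℝ => 1 - c * t) (Ioo (0:ℝ) 1) := by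
    intro t₁ _ t₂ _ h12
    have h' : c * t₁ = c * t₂ := by simp only at h12; linarith
    exact mul_left_cancel₀ hc.ne' h'
  rw [← himg, lintegral_image_eq_lintegral_abs_deriv_mul measurableSet_Ioo hderiv hinj h]
  simp only [abs_neg, abs_of_pos hc]
  rw [lintegral_const_mul' _ _ ENNReal.ofReal_ne_top]

/-! ### The zigzag cell `{u ∈ (0,1)^n : u_{k−1} + u_k > 1}` -/

/-- The zigzag cell is measurable. [cite: Fischler2003RhinViola, §4.2 Proposition 14 (with Prop. 11)] -/
theorem measurableSet_cell (n : ℕ) :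
    MeasurableSet {u : Fin n → ℝ | (∀ i, 0 < u i ∧ u i < 1) ∧ ∀ i j : Fin n, j.1 = i.1 + 1 → 1 < u i + u j} := by
  have h1 : {u : Fin n → ℝ | (∀ i, 0 < u i ∧ u i < 1) ∧ ∀ i j : Fin n, j.1 = i.1 + 1 → 1 < u i + u j} =
      (⋂ i : Fin n, {u : Fin n → ℝ | 0 < u i} ∩ {u | u i < 1}) ∩
        ⋂ i : Fin n, ⋂ j : Fin n, {u : Fin n → ℝ | j.1 = i.1 + 1 → 1 < u i + u j} := by
    ext u
    simp only [Set.mem_setOf_eq, Set.mem_inter_iff, Set.mem_iInter]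
  rw [h1]
  refine (MeasurableSet.iInter fun i => (measurableSet_lt measurable_const (measurable_pi_apply i)).inter
    (measurableSet_lt (measurable_pi_apply i) measurable_const)).inter
    (MeasurableSet.iInter fun i => MeasurableSet.iInter fun j => ?_)
  by_cases hij : j.1 = i.1 + 1
  · have : {u : Fin n → ℝ | j.1 = i.1 + 1 → 1 < u i + u j} = {u | 1 < u i + u j} := by
      ext u; simp only [Set.mem_setOf_eq]; exact ⟨fun h => h hij, fun h _ => h⟩
    rw [this]
    exact measurableSet_lt measurable_const ((measurable_pi_apply i).add (measurable_pi_apply j))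
  · have : {u : Fin n → ℝ | j.1 = i.1 + 1 → 1 < u i + u j} = Set.univ := by
      ext u; simp only [Set.mem_setOf_eq, Set.mem_univ, iff_true]; exact fun h => absurd h hij
    rw [this]
    exact MeasurableSet.univ

/-- If `(u′, s)` lies in the `(m+1)`-cell then `u′` lies in the `m`-cell. [cite: Fischler2003RhinViola, §4.2 Proposition 14 (with Prop. 11)] -/
theorem init_mem_cell_of_snoc_mem_cell {m : ℕ} {u' : Fin m → ℝ} {s : ℝ}
    (h : (Fin.snoc u' s : Fin (m + 1) → ℝ) ∈
      {u : Fin (m + 1) → ℝ | (∀ i, 0 < u i ∧ u i < 1) ∧ ∀ i j : Fin (m + 1), j.1 = i.1 + 1 → 1 < u i + u j}) :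
    u' ∈ {u : Fin m → ℝ | (∀ i, 0 < u i ∧ u i < 1) ∧ ∀ i j : Fin m, j.1 = i.1 + 1 → 1 < u i + u j} := by
  obtain ⟨h1, h2⟩ := h
  refine ⟨fun i => ?_, fun i j hij => ?_⟩
  · have := h1 (Fin.castSucc i)
    rwa [Fin.snoc_castSucc] at this
  · have := h2 (Fin.castSucc i) (Fin.castSucc j) (by simpa using hij)
    rwa [Fin.snoc_castSucc, Fin.snoc_castSucc] at this

/-- On the open cube the nested coordinates `(δ₁(x),…,δ_m(x))` lie in the zigzag cell: `0 < δ_k < 1` and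
`δ_k + δ_{k+1} = δ_k + 1 − x_{k+1}δ_k > 1`. [cite: Fischler2003RhinViola, §4.2 Proposition 14 (with Prop. 11)] -/
theorem deltaMap_mem_cell {m : ℕ} {x : Fin m → ℝ} (hx : ∀ i, 0 < x i ∧ x i < 1) :
    (fun i : Fin m => deltaV x (i.1 + 1)) ∈
      {u : Fin m → ℝ | (∀ i, 0 < u i ∧ u i < 1) ∧ ∀ i j : Fin m, j.1 = i.1 + 1 → 1 < u i + u j} := by
  refine ⟨fun i => ?_, fun i j hij => ?_⟩
  · have hi := i.2
    obtain ⟨h0, -, h1⟩ := deltaV_mem hx (i.1 + 1) (by omega)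
    exact ⟨h0, h1 (by omega)⟩
  · have hj := j.2
    show 1 < deltaV x (i.1 + 1) + deltaV x (j.1 + 1)
    rw [hij, show deltaV x (i.1 + 1 + 1) = 1 - coord x (i.1 + 1 + 1) * deltaV x (i.1 + 1) from rfl]
    obtain ⟨h0, -, -⟩ := deltaV_mem hx (i.1 + 1) (by omega)
    have hc : coord x (i.1 + 1 + 1) < 1 := by
      unfold coord
      rw [dif_pos ⟨by omega, by omega⟩]
      exact (hx _).2
    nlinarith [mul_pos h0 (sub_pos.mpr hc)]

/-- **The fibre of the `(m+1)`-cell over `u′ = δ(x′)` is the interval `(1 − δ_m(x′), 1)`** (`δ₀ = 1` when `m = 0`).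
[cite: Fischler2003RhinViola, §4.2 Proposition 14 (with Prop. 11)] -/
theorem snoc_deltaMap_mem_cell_iff {m : ℕ} {x : Fin m → ℝ} (hx : ∀ i, 0 < x i ∧ x i < 1) (s : ℝ) :
    (Fin.snoc (fun i : Fin m => deltaV x (i.1 + 1)) s : Fin (m + 1) → ℝ) ∈
        {u : Fin (m + 1) → ℝ | (∀ i, 0 < u i ∧ u i < 1) ∧ ∀ i j : Fin (m + 1), j.1 = i.1 + 1 → 1 < u i + u j} ↔
      1 - deltaV x m < s ∧ s < 1 := by
  have hδ := deltaV_mem hx m le_rfl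
  have hU := deltaMap_mem_cell hx
  constructor
  · rintro ⟨h1, h2⟩
    have hs := h1 (Fin.last m)
    rw [Fin.snoc_last] at hs
    refine ⟨?_, hs.2⟩
    rcases Nat.eq_zero_or_pos m with hm | hm
    · subst hm
      simp only [deltaV, sub_self]
      exact hs.1
    · have h12 := h2 (Fin.castSucc ⟨m - 1, by omega⟩) (Fin.last m) (by simp; omega)
      rw [Fin.snoc_castSucc, Fin.snoc_last] at h12
      have e : m - 1 + 1 = m := by omega
      simp only [e] at h12
      linarith
  · rintro ⟨hs1, hs2⟩
    have hs0 : 0 < s := by linarith [hδ.2.1]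
    refine ⟨fun i => ?_, fun i j hij => ?_⟩
    · by_cases hi : i = Fin.last m
      · subst hi
        rw [Fin.snoc_last]
        exact ⟨hs0, hs2⟩
      · rw [← Fin.castSucc_castPred i hi, Fin.snoc_castSucc]
        exact hU.1 _
    · have hi : i ≠ Fin.last m := by
        intro h
        subst h
        have := j.2
        simp at hij
        omega
      by_cases hj : j = Fin.last m
      · subst hj
        rw [← Fin.castSucc_castPred i hi, Fin.snoc_castSucc, Fin.snoc_last]
        have e : (i.castPred hi).1 + 1 = m := by
          rw [Fin.coe_castPred]
          simp at hij
          omega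
        show 1 < deltaV x ((i.castPred hi).1 + 1) + s
        rw [e]
        linarith
      · rw [← Fin.castSucc_castPred i hi, ← Fin.castSucc_castPred j hj, Fin.snoc_castSucc, Fin.snoc_castSucc]
        exact hU.2 _ _ (by simpa using hij)

/-- The nested coordinates of `(x′, t)`: `δ(x′, t) = (δ(x′), 1 − tδ_m(x′))`. [cite: Fischler2002Polyzetas, §1 p. 2 (definition of δ_k)] -/
theorem deltaMap_snoc {m : ℕ} (x' : Fin m → ℝ) (t : ℝ) :
    (fun i : Fin (m + 1) => deltaV (Fin.snoc x' t : Fin (m + 1) → ℝ) (i.1 + 1)) =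
      Fin.snoc (fun i : Fin m => deltaV x' (i.1 + 1)) (1 - t * deltaV x' m) := by
  funext i
  by_cases hi : i = Fin.last m
  · subst hi
    rw [Fin.snoc_last, Fin.val_last, deltaV_snoc_last]
  · obtain ⟨j, rfl⟩ : ∃ j : Fin m, i = Fin.castSucc j := ⟨i.castPred hi, (Fin.castSucc_castPred i hi).symm⟩
    rw [Fin.snoc_castSucc, Fin.val_castSucc]
    have hj := j.2
    exact deltaV_snoc_of_le x' t (by omega)

/-- The Jacobian weight does not see the last coordinate: `∏_{k ≤ m} δ_k(x′, t) = ∏_{k ≤ m} δ_k(x′)`.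
[cite: Fischler2002Polyzetas, §1 p. 2 (definition of δ_k)] -/
theorem prod_deltaV_snoc {m : ℕ} (x' : Fin m → ℝ) (t : ℝ) :
    ∏ k ∈ Finset.range (m + 1), deltaV (Fin.snoc x' t : Fin (m + 1) → ℝ) k =
      ∏ k ∈ Finset.range (m + 1), deltaV x' k :=
  Finset.prod_congr rfl fun k hk => deltaV_snoc_of_le x' t (by have := Finset.mem_range.1 hk; omega)

/-- The Jacobian weight is positive on the open cube. [cite: Fischler2002Polyzetas, §1 p. 2 (definition of δ_k)] -/
theorem prod_deltaV_pos {m : ℕ} {x : Fin m → ℝ} (hx : ∀ i, 0 < x i ∧ x i < 1) {N : ℕ} (hN : N ≤ m + 1) :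
    0 < ∏ k ∈ Finset.range N, deltaV x k :=
  Finset.prod_pos fun k hk => (deltaV_mem hx k (by have := Finset.mem_range.1 hk; omega)).1

/-- The nested coordinate map `x ↦ (δ₁(x),…,δ_n(x))` is measurable. [cite: Fischler2002Polyzetas, §1 p. 2 (definition of δ_k)] -/
theorem measurable_deltaMap (n : ℕ) : Measurable fun x : Fin n → ℝ => fun i : Fin n => deltaV x (i.1 + 1) :=
  measurable_pi_lambda _ fun _ => measurable_deltaV _

/-! ### The substitution theorem `u = δ(x)` -/

/-- **Substitution theorem for the nested coordinates** (`u_k = δ_k(x)`, `dx = du/∏_{k<n}u_k`): for every `n` and every measurable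
`G : ℝ^n → [0,∞]`,
`∫⁻_{u ∈ cell} G(u) du = ∫⁻_{x ∈ (0,1)^n} G(δ₁(x),…,δ_n(x)) · ∏_{k<n} δ_k(x) dx`,
where `cell = {u ∈ (0,1)^n : u_{k−1} + u_k > 1 (2 ≤ k ≤ n)}`. By induction on `n`: the last variable is split off on both sides
(Tonelli), the fibre of the `(m+1)`-cell over `δ(x′)` is `(1 − δ_m(x′), 1)`, and there `s = 1 − tδ_m(x′)`, `ds = δ_m(x′)dt` — no
`n × n` Jacobian is computed. [cite: Fischler2003RhinViola, §4.2 Proposition 14 (with Prop. 11)] [cite: Fischler2002Polyzetas, §3 p. 3 (𝒥(p) = 𝒥(ψ(p)))] -/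
theorem lintegral_cell_eq_lintegral_cube (n : ℕ) (G : (Fin n → ℝ) → ℝ≥0∞) (hG : Measurable G) :
    ∫⁻ u in {u : Fin n → ℝ | (∀ i, 0 < u i ∧ u i < 1) ∧ ∀ i j : Fin n, j.1 = i.1 + 1 → 1 < u i + u j}, G u =
      ∫⁻ x in Set.pi Set.univ (fun _ : Fin n => Ioo (0:ℝ) 1),
        G (fun i => deltaV x (i.1 + 1)) * ENNReal.ofReal (∏ k ∈ Finset.range n, deltaV x k) := by
  induction n with
  | zero =>
    have h1 : {u : Fin 0 → ℝ | (∀ i, 0 < u i ∧ u i < 1) ∧ ∀ i j : Fin 0, j.1 = i.1 + 1 → 1 < u i + u j} = Set.univ :=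
      Set.eq_univ_of_forall fun u => ⟨fun i => i.elim0, fun i => i.elim0⟩
    have h2 : (Set.pi Set.univ fun _ : Fin 0 => Ioo (0:ℝ) 1) = Set.univ :=
      Set.eq_univ_of_forall fun x => Set.mem_univ_pi.mpr fun i => i.elim0
    rw [h1, h2]
    refine lintegral_congr fun x => ?_
    rw [Finset.prod_range_zero, ENNReal.ofReal_one, mul_one]
    congr 1
    exact Subsingleton.elim _ _
  | succ m ih =>
    -- the cells in dimensions `m + 1` and `m`
    set C := {u : Fin (m + 1) → ℝ | (∀ i, 0 < u i ∧ u i < 1) ∧ ∀ i j : Fin (m + 1), j.1 = i.1 + 1 → 1 < u i + u j}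
      with hC
    set C' := {u : Fin m → ℝ | (∀ i, 0 < u i ∧ u i < 1) ∧ ∀ i j : Fin m, j.1 = i.1 + 1 → 1 < u i + u j} with hC'
    have hCm : MeasurableSet C := measurableSet_cell (m + 1)
    have hC'm : MeasurableSet C' := measurableSet_cell m
    -- the inner integral over the last coordinate, as a function of `u′ ∈ ℝ^m`
    set Φ : (Fin m → ℝ) → ℝ≥0∞ := fun u' => ∫⁻ s, C.indicator G (Fin.snoc u' s) with hΦ
    have hΦmeas : Measurable Φ := by
      have h : Measurable fun z : (Fin m → ℝ) × ℝ => C.indicator G (Fin.snoc z.1 z.2) :=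
        (hG.indicator hCm).comp measurable_snoc_prod
      exact h.lintegral_prod_right'
    have step1 : ∫⁻ u in C, G u = ∫⁻ u', Φ u' := setLIntegral_eq_lintegral_snoc hCm G hG
    -- `Φ` vanishes off the `m`-cell
    have hΦC' : Φ = C'.indicator Φ := by
      funext u'
      by_cases hu' : u' ∈ C'
      · rw [Set.indicator_of_mem hu']
      · rw [Set.indicator_of_notMem hu', hΦ]
        have h0 : ∀ s, C.indicator G (Fin.snoc u' s) = 0 := fun s =>
          Set.indicator_of_notMem (fun h => hu' (init_mem_cell_of_snoc_mem_cell h)) _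
        simp only [h0, lintegral_zero]
    have step2 : ∫⁻ u', Φ u' = ∫⁻ u' in C', Φ u' := by
      rw [← lintegral_indicator hC'm]
      exact congrArg (fun f : (Fin m → ℝ) → ℝ≥0∞ => ∫⁻ u', f u') hΦC'
    -- the induction hypothesis, applied to `Φ`
    have step3 := ih Φ hΦmeas
    -- the fibre over `u′ = δ(x′)` is `(1 − δ_m(x′), 1)`; substitute `s = 1 − tδ_m(x′)` there
    have step4 : ∀ x' ∈ Set.pi Set.univ (fun _ : Fin m => Ioo (0:ℝ) 1),
        Φ (fun i => deltaV x' (i.1 + 1)) = ENNReal.ofReal (deltaV x' m) *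
          ∫⁻ t in Ioo (0:ℝ) 1, G (Fin.snoc (fun i : Fin m => deltaV x' (i.1 + 1)) (1 - deltaV x' m * t)) := by
      intro x' hx'
      have hx : ∀ i, 0 < x' i ∧ x' i < 1 := fun i => hx' i (Set.mem_univ _)
      have hδ := deltaV_mem hx m le_rfl
      have hind : (fun s => C.indicator G (Fin.snoc (fun i : Fin m => deltaV x' (i.1 + 1)) s)) =
          (Ioo (1 - deltaV x' m) 1).indicator
            (fun s => G (Fin.snoc (fun i : Fin m => deltaV x' (i.1 + 1)) s)) := by
        funext s
        by_cases hs : 1 - deltaV x' m < s ∧ s < 1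
        · rw [Set.indicator_of_mem ((snoc_deltaMap_mem_cell_iff hx s).mpr hs),
            Set.indicator_of_mem (show s ∈ Ioo (1 - deltaV x' m) 1 from hs)]
        · rw [Set.indicator_of_notMem (fun h => hs ((snoc_deltaMap_mem_cell_iff hx s).mp h)),
            Set.indicator_of_notMem (show s ∉ Ioo (1 - deltaV x' m) 1 from hs)]
      rw [hΦ]
      simp only
      rw [hind, lintegral_indicator measurableSet_Ioo, lintegral_Ioo_one_sub_mul hδ.1]
    -- measurability of the right-hand integrand in dimension `m + 1`
    have hmeas : Measurable fun x : Fin (m + 1) → ℝ =>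
        G (fun i => deltaV x (i.1 + 1)) * ENNReal.ofReal (∏ k ∈ Finset.range (m + 1), deltaV x k) :=
      (hG.comp (measurable_deltaMap (m + 1))).mul
        (Finset.measurable_prod _ fun k _ => measurable_deltaV k).ennreal_ofReal
    -- assemble
    rw [step1, step2, step3, lintegral_openCube_succ _ hmeas]
    refine setLIntegral_congr_fun (measurableSet_openCube m) fun x' hx' => ?_
    have hx : ∀ i, 0 < x' i ∧ x' i < 1 := fun i => hx' i (Set.mem_univ _)
    rw [step4 x' hx']
    have hinner : ∀ t : ℝ,
        G (fun i : Fin (m + 1) => deltaV (Fin.snoc x' t : Fin (m + 1) → ℝ) (i.1 + 1)) *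
            ENNReal.ofReal (∏ k ∈ Finset.range (m + 1), deltaV (Fin.snoc x' t : Fin (m + 1) → ℝ) k) =
          G (Fin.snoc (fun i : Fin m => deltaV x' (i.1 + 1)) (1 - deltaV x' m * t)) *
            (ENNReal.ofReal (∏ k ∈ Finset.range m, deltaV x' k) * ENNReal.ofReal (deltaV x' m)) := by
      intro t
      rw [deltaMap_snoc, prod_deltaV_snoc, Finset.prod_range_succ,
        ENNReal.ofReal_mul (prod_deltaV_pos hx (Nat.le_succ m)).le, mul_comm t]
    simp only [hinner]
    rw [lintegral_mul_const' _ _ (by finiteness)]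
    ring

/-! ### Reversal invariance of the cell -/

/-- **The zigzag cell and its volume are invariant under the coordinate reversal `u_k ↦ u_{n+1−k}`**: for every `G ≥ 0`,
`∫⁻_{cell} G(u) du = ∫⁻_{cell} G(u ∘ rev) du` (`MeasurableEquiv.piCongrLeft` at `Fin.revPerm` preserves Lebesgue measure, and
reversal maps adjacent indices to adjacent indices). [cite: Fischler2003RhinViola, §4.2 Proposition 14 (with Prop. 11)] [cite: Fischler2002Polyzetas, §3 p. 3 (𝒥(p) = 𝒥(ψ(p)))] -/
theorem lintegral_cell_rev (n : ℕ) (G : (Fin n → ℝ) → ℝ≥0∞) :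
    ∫⁻ u in {u : Fin n → ℝ | (∀ i, 0 < u i ∧ u i < 1) ∧ ∀ i j : Fin n, j.1 = i.1 + 1 → 1 < u i + u j}, G u =
      ∫⁻ u in {u : Fin n → ℝ | (∀ i, 0 < u i ∧ u i < 1) ∧ ∀ i j : Fin n, j.1 = i.1 + 1 → 1 < u i + u j},
        G (fun i => u (Fin.rev i)) := by
  set C := {u : Fin n → ℝ | (∀ i, 0 < u i ∧ u i < 1) ∧ ∀ i j : Fin n, j.1 = i.1 + 1 → 1 < u i + u j} with hC
  set e := MeasurableEquiv.piCongrLeft (fun _ : Fin n => ℝ) Fin.revPerm with he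
  have hmp : MeasurePreserving e volume volume :=
    volume_measurePreserving_piCongrLeft (fun _ : Fin n => ℝ) Fin.revPerm
  have he' : ∀ u : Fin n → ℝ, e u = fun i => u (Fin.rev i) := by
    intro u
    funext i
    simp only [he, MeasurableEquiv.coe_piCongrLeft, Equiv.piCongrLeft_apply, eq_rec_constant, Fin.revPerm_symm,
      Fin.revPerm_apply]
  have hpre : e ⁻¹' C = C := by
    ext u
    simp only [Set.mem_preimage, he', hC, Set.mem_setOf_eq]
    constructor
    · rintro ⟨h1, h2⟩
      refine ⟨fun i => by simpa using h1 (Fin.rev i), fun i j hij => ?_⟩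
      have hi := i.2
      have hj := j.2
      have h12 := h2 (Fin.rev j) (Fin.rev i) (by rw [Fin.val_rev, Fin.val_rev]; omega)
      rw [Fin.rev_rev, Fin.rev_rev] at h12
      linarith
    · rintro ⟨h1, h2⟩
      refine ⟨fun i => h1 (Fin.rev i), fun i j hij => ?_⟩
      have hi := i.2
      have hj := j.2
      have h12 := h2 (Fin.rev j) (Fin.rev i) (by rw [Fin.val_rev, Fin.val_rev]; omega)
      linarith
  have h := hmp.setLIntegral_comp_preimage_emb e.measurableEmbedding G C
  rw [hpre] at h
  rw [← h]
  exact lintegral_congr fun u => by rw [he']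

end JnPsi

end Literature.NumberTheory.Irrationality.Fischler2002

end
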